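import Mathlib
import Literature.Computability.Complexity.CircuitComposition
import Literature.Computability.Complexity.NegationElimination
import Literature.Computability.Complexity.NegationLimitedProofs
import Literature.Computability.Complexity.PseudoComplementCircuits

/-!
# `ResolutionUncertainty` (stmt-PneNP-9816), negative side of line `jukna-game-monotone-interpolation`:
# two cheap monotone separators of Alice cliques from Bob shadows

Support file of the deep refuter (drefute gen 3) for the stub set of
`Cruxes/ResolutionUncertainty/Lines/jukna-game-monotone-interpolation.lean`. Its engine
`ShadowLowerBound` (stub 2) asks for an `n^{ε log n}` lower bound on every
`{∧₂, ∨₂, 0, 1}`-circuit over the vertex variables that accepts the indicator `1_x`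
(`fun v => decide (v ∈ x)`, the skeleton's `posVec x`) of every `kA`-clique `x ⊆ A` and rejects
the shadow `1_{A ∩ N(y)}` (`fun v => decide (v ∈ A ∧ ∀ w ∈ y, H.Adj v w)`, the skeleton's
`shadowVec H A y`) of every `kB`-clique `y ⊆ B`. This file is definition-free and proves:

* `cktSize_countZeroBlocks` / `exists_circuit_fewZeroBlocks` — the textbook counting network
  "at most `j₀` of the block-ORs `⋁_{v ∈ blk b} x_v` (`b ∈ S`) vanish", one layer
  `D'_{j+1} = D_j ∨ (D_{j+1} ∧ q)` per block, `≤ 1 + |S| (m + 2 j₀ + 3)` gates, assembled in the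
  tree's `CktSize` calculus (`CircuitComposition`).
* `exists_partite_separator` — if the vertices carry a proper colouring with `m` colours,
  `kA ≤ m < kA + kB`, the instance "at most `m - kA` colour classes of `A` are dark"
  (`≤ 1 + m (n + 2 (m - kA) + 3)` gates) accepts every `kA`-clique of `A` and rejects every
  shadow of a `kB`-clique: the deterministic half of the gen-2 refuter's counterexample to the
  REGISTERED `ShadowLowerBound` (balanced `(k-1)`-partite `G(n,½)`-like graphs are rich splits;
  `Cruxes/ResolutionUncertainty/DREFUTE-g2-stub_shadowLowerBound.md`).
* `exists_threshold_separator` — on EVERY graph, the instance "at most `kB - 1` of the Bob ORs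
  `q_w = ⋁_{v ∈ A, v ≁ w} z_v` (`w ∈ B`) vanish" (`≤ 1 + |B| (n + 2 kB + 1)` gates) rejects the
  shadow of every `kB`-subset of `B` and accepts every `x ⊆ A` with fewer than `kB` common
  neighbours in `B`: a monotone lower bound for the (Ramsey-repaired) engine can only be carried
  by the "bad" Alice cliques, those with `≥ kB` common Bob-neighbours (`BadCliques.lean`).

Everything is [folklore].
-/

-- `Summit.PneNP.PneNP.…` repeats `PneNP` by the tree's layout (summit = problem).
set_option linter.dupNamespace false

namespace Summit.PneNP.PneNP.Theorems.ResolutionUncertainty.Negative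

open Literature.Computability.Complexity

universe u

section Generic

variable {ι : Type u}

/-! ## Gates over `{∧₂, ∨₂, 0, 1}` in the `CktSize` calculus -/

/-- The disjunction of two inputs costs one gate over `{∧₂, ∨₂, 0, 1}` (the tree's
`cktSize_or_mono` over `{∧₂, ∨₂}`, basis enlarged). [folklore] -/
theorem cktSize_or01 (i j : ι) :
    CktSize monotoneBasis01 (fun (x : ι → Bool) (_ : Unit) => (x i || x j)) 1 :=
  (cktSize_or_mono i j).basis_mono monotoneBasis_subset_monotoneBasis01

/-- The conjunction of two inputs costs one gate over `{∧₂, ∨₂, 0, 1}` (the tree's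
`cktSize_and_mono`, basis enlarged). [folklore] -/
theorem cktSize_and01 (i j : ι) :
    CktSize monotoneBasis01 (fun (x : ι → Bool) (_ : Unit) => (x i && x j)) 1 :=
  (cktSize_and_mono i j).basis_mono monotoneBasis_subset_monotoneBasis01

/-- The OR of the inputs listed in `T` (`false` for the empty list): `|T| + 1` gates.
[folklore] -/
theorem cktSize_listOr (T : List ι) :
    CktSize monotoneBasis01 (fun (x : ι → Bool) (_ : Unit) => T.any x) (T.length + 1) := by
  induction T with
  | nil => exact (cktSize_const_mono01 ι false).congr fun x _ => by simp
  | cons i T ih =>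
    have h1 : CktSize monotoneBasis01
        (fun (x : ι → Bool) => Sum.elim x (fun (_ : Unit) => T.any x)) (0 + (T.length + 1)) :=
      (CktSize.id _).pair ih
    have h2 : CktSize monotoneBasis01
        (fun (y : ι ⊕ Unit → Bool) (_ : Unit) => (y (.inl i) || y (.inr ()))) 1 :=
      cktSize_or01 _ _
    refine ((h1.comp h2).of_le (by simp)).congr fun x _ => ?_
    simp [List.any_cons]

/-! ## The counting network -/

/-- One update coordinate of a counting layer, reading the old counters `D_j` (wires
`inl (inr j)`) and the new block-OR `q` (wire `inr ()`): `D'_0 = D_0 ∧ q`,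
`D'_{j+1} = D_j ∨ (D_{j+1} ∧ q)`; at most `2` gates. [folklore] -/
theorem cktSize_update (j₀ : ℕ) (j : Fin (j₀ + 1)) :
    CktSize monotoneBasis01 (fun (y : (ι ⊕ Fin (j₀ + 1)) ⊕ Unit → Bool) (_ : Unit) =>
      if (j : ℕ) = 0 then (y (.inl (.inr j)) && y (.inr ()))
      else (y (.inl (.inr ⟨(j : ℕ) - 1, by omega⟩)) || (y (.inl (.inr j)) && y (.inr ())))) 2 := by
  by_cases h : (j : ℕ) = 0
  · refine ((cktSize_and01 (ι := (ι ⊕ Fin (j₀ + 1)) ⊕ Unit) (.inl (.inr j)) (.inr ())).of_le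
      (by norm_num)).congr fun y _ => ?_
    simp [h]
  · have h1 : CktSize monotoneBasis01 (fun (y : (ι ⊕ Fin (j₀ + 1)) ⊕ Unit → Bool) =>
        Sum.elim y (fun (_ : Unit) => (y (.inl (.inr j)) && y (.inr ())))) (0 + 1) :=
      (CktSize.id _).pair (cktSize_and01 _ _)
    have h2 : CktSize monotoneBasis01
        (fun (z : ((ι ⊕ Fin (j₀ + 1)) ⊕ Unit) ⊕ Unit → Bool) (_ : Unit) =>
          (z (.inl (.inl (.inr ⟨(j : ℕ) - 1, by omega⟩))) || z (.inr ()))) 1 :=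
      cktSize_or01 _ _
    refine ((h1.comp h2).of_le (by norm_num)).congr fun y _ => ?_
    simp [h]

/-- **The counting network.** For every block list `Ts` with blocks of length `≤ m` and every
threshold `j₀`, the map `x ↦ (x, ([#{T ∈ Ts : ⋁_{v∈T} x_v = 0} ≤ j])_{j ≤ j₀})` has a
`{∧₂, ∨₂, 0, 1}`-program with at most `1 + |Ts| (m + 2 j₀ + 3)` gates (one constant; per block
its OR and one update layer; inputs pass through for free). [folklore] -/
theorem cktSize_countZeroBlocks (j₀ m : ℕ) : ∀ Ts : List (List ι), (∀ T ∈ Ts, T.length ≤ m) →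
    CktSize monotoneBasis01 (fun (x : ι → Bool) => Sum.elim x (fun j : Fin (j₀ + 1) =>
      decide (Ts.countP (fun T => !(T.any x)) ≤ j))) (1 + Ts.length * (m + 2 * j₀ + 3))
  | [], _ => by
    have h : CktSize monotoneBasis01
        (fun (x : ι → Bool) => Sum.elim x (fun (_ : Fin (j₀ + 1)) => true)) (0 + 1) :=
      (CktSize.id _).pair ((cktSize_const_mono01 ι true).outMap fun _ => ())
    exact (h.of_le (by simp)).congr fun x k => by cases k <;> simp
  | T :: Ts, hm => by
    have hT : T.length ≤ m := hm T (by simp)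
    have ih := cktSize_countZeroBlocks j₀ m Ts fun T' hT' => hm T' (by simp [hT'])
    -- stage A: the counters of `Ts` (with the inputs) and the OR of the new block `T`
    have hA := ih.pair (cktSize_listOr T)
    -- stage B: pass the inputs, update every counter
    have hB : CktSize monotoneBasis01 (fun (y : (ι ⊕ Fin (j₀ + 1)) ⊕ Unit → Bool) =>
        Sum.elim (fun v : ι => y (.inl (.inl v))) (fun j : Fin (j₀ + 1) =>
          if (j : ℕ) = 0 then (y (.inl (.inr j)) && y (.inr ()))
          else (y (.inl (.inr ⟨(j : ℕ) - 1, by omega⟩)) || (y (.inl (.inr j)) && y (.inr ())))))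
        (0 + Fintype.card (Fin (j₀ + 1)) * 2) :=
      (CktSize.proj monotoneBasis01 fun v : ι =>
          (Sum.inl (Sum.inl v) : (ι ⊕ Fin (j₀ + 1)) ⊕ Unit)).pair
        (CktSize.pi_const fun j => cktSize_update j₀ j)
    have hcons : ∀ x : ι → Bool, (T :: Ts).countP (fun T => !(T.any x)) =
        Ts.countP (fun T => !(T.any x)) + (if T.any x then 0 else 1) := fun x => by
      rw [List.countP_cons]
      cases T.any x <;> simp
    refine ((hA.comp hB).of_le ?_).congr fun x k => ?_
    · simp only [Fintype.card_fin, List.length_cons]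
      nlinarith
    · cases k with
      | inl v => simp
      | inr j =>
        simp only [Sum.elim_inr, Sum.elim_inl, hcons]
        by_cases hj : (j : ℕ) = 0
        · simp only [hj, if_true]
          cases hq : T.any x <;> simp
        · simp only [hj, if_false]
          cases hq : T.any x
          · simp only [Bool.and_false, Bool.or_false]
            by_cases hc : Ts.countP (fun T => !(T.any x)) ≤ (j : ℕ) - 1
            · rw [decide_eq_true hc, decide_eq_true (by simp; omega)]
            · rw [decide_eq_false hc, decide_eq_false (by simp; omega)]
          · simp only [Bool.and_true]
            by_cases hc : Ts.countP (fun T => !(T.any x)) ≤ (j : ℕ)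
            · rw [decide_eq_true hc, Bool.or_true, decide_eq_true (by simp; omega)]
            · rw [decide_eq_false hc, Bool.or_false]
              by_cases hc' : Ts.countP (fun T => !(T.any x)) ≤ (j : ℕ) - 1
              · exact absurd (hc'.trans (Nat.sub_le _ _)) hc
              · rw [decide_eq_false hc', decide_eq_false (by simp; omega)]

/-- `countP` along the enumeration of a finset is the cardinality of the filter. [folklore] -/
theorem countP_toList {β : Type*} (S : Finset β) (p : β → Bool) :
    S.toList.countP p = (S.filter fun b => p b = true).card := by
  classical
  have h : S.toList.countP p = Multiset.countP (fun b => p b = true) (S.toList : Multiset β) := by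
    rw [Multiset.coe_countP]
    congr 1
    funext b
    simp
  rw [h, Finset.coe_toList, Multiset.countP_eq_card_filter, Finset.card_def, Finset.filter_val]

/-- **Few vanishing blocks, as a program.** For blocks `blk b ⊆ ι` (`b ∈ S`) of size `≤ m` and
a threshold `j₀`, a `{∧₂, ∨₂, 0, 1}`-program with `≤ 1 + |S| (m + 2 j₀ + 3)` gates decides
`[#{b ∈ S : x vanishes on blk b} ≤ j₀]` — stated through the two certificate forms used below
(a set `Z` with `|Z| ≤ j₀` containing every index of a vanishing block ⇒ accept; more than `j₀`
indices of vanishing blocks ⇒ reject), so that no decidability instance leaks; `CktSize` form,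
for further composition. [folklore] -/
theorem exists_cktSize_fewZeroBlocks {β : Type*} (S : Finset β) (blk : β → Finset ι)
    (j₀ m : ℕ) (hm : ∀ b ∈ S, (blk b).card ≤ m) :
    ∃ f : (ι → Bool) → Unit → Bool, CktSize monotoneBasis01 f (1 + S.card * (m + 2 * j₀ + 3)) ∧
      (∀ (x : ι → Bool) (Z : Finset β), (∀ b ∈ S, (∀ v ∈ blk b, x v = false) → b ∈ Z) →
        Z.card ≤ j₀ → f x () = true) ∧
      (∀ (x : ι → Bool) (Y : Finset β), Y ⊆ S → j₀ < Y.card →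
        (∀ b ∈ Y, ∀ v ∈ blk b, x v = false) → f x () = false) := by
  classical
  set Ts : List (List ι) := S.toList.map fun b => (blk b).toList with hTs
  have hlen : ∀ T ∈ Ts, T.length ≤ m := fun T hT => by
    obtain ⟨b, hb, rfl⟩ := List.mem_map.1 hT
    rw [Finset.length_toList]
    exact hm b (Finset.mem_toList.1 hb)
  have h := (cktSize_countZeroBlocks j₀ m Ts hlen).outMap fun _ : Unit =>
    (Sum.inr (Fin.last j₀) : ι ⊕ Fin (j₀ + 1))
  have hz : ∀ x : ι → Bool,
      Ts.countP (fun T => !(T.any x)) = (S.filter fun b => ∀ v ∈ blk b, x v = false).card := by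
    intro x
    simp only [hTs, List.countP_map]
    rw [countP_toList]
    congr 1
    refine Finset.filter_congr fun b _ => ?_
    simp [List.any_eq_false]
  have hcard : Ts.length = S.card := by simp [hTs]
  refine ⟨_, hcard ▸ h, fun x Z hZ hj => ?_, fun x Y hYS hj hY => ?_⟩
  · simp only [Sum.elim_inr, Fin.val_last, hz, decide_eq_true_iff]
    refine le_trans (Finset.card_le_card fun b hb => ?_) hj
    rw [Finset.mem_filter] at hb
    exact hZ b hb.1 hb.2
  · simp only [Sum.elim_inr, Fin.val_last, hz, decide_eq_false_iff_not, not_le]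
    refine lt_of_lt_of_le hj (Finset.card_le_card fun b hb => ?_)
    rw [Finset.mem_filter]
    exact ⟨hYS hb, hY b hb⟩

/-- **Few vanishing blocks, as a circuit** (`exists_cktSize_fewZeroBlocks` turned into a
`Circuit`). [folklore] -/
theorem exists_circuit_fewZeroBlocks {β : Type*} (S : Finset β) (blk : β → Finset ι)
    (j₀ m : ℕ) (hm : ∀ b ∈ S, (blk b).card ≤ m) :
    ∃ C : Circuit ι, C.IsOver monotoneBasis01 ∧ C.size ≤ 1 + S.card * (m + 2 * j₀ + 3) ∧
      (∀ (x : ι → Bool) (Z : Finset β), (∀ b ∈ S, (∀ v ∈ blk b, x v = false) → b ∈ Z) →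
        Z.card ≤ j₀ → C.eval x = true) ∧
      (∀ (x : ι → Bool) (Y : Finset β), Y ⊆ S → j₀ < Y.card →
        (∀ b ∈ Y, ∀ v ∈ blk b, x v = false) → C.eval x = false) := by
  obtain ⟨f, hf, hacc, hrej⟩ := exists_cktSize_fewZeroBlocks S blk j₀ m hm
  obtain ⟨C, hC, hsize, heval⟩ := hf.toCircuit
  exact ⟨C, hC, hsize, fun x Z hZ hj => (heval x).trans (hacc x Z hZ hj),
    fun x Y hYS hj hY => (heval x).trans (hrej x Y hYS hj hY)⟩

end Generic

/-! ## The partite (colour-counting) separator -/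

variable {n : ℕ}

/-- **The `(k-1)`-partite separator** (deterministic half of the gen-2 counterexample to the
registered `ShadowLowerBound`). If the vertices carry a proper colouring `col` with `m`
colours and `kA ≤ m < kA + kB`, then the monotone circuit "at most `m - kA` colour classes of
`A` are dark", of size `≤ 1 + m (n + 2 (m - kA) + 3)`, accepts `1_x` for every `kA`-clique
`x ⊆ A` (its vertices have `kA` distinct colours) and rejects the shadow `1_{A ∩ N(y)}` of
every `kB`-clique `y` (each of the `kB` colours of `y` darkens its whole class, and
`kB > m - kA`). Test vectors written exactly as in the skeleton's `posVec` / `shadowVec`.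
[folklore] -/
theorem exists_partite_separator {m : ℕ} (H : SimpleGraph (Fin n)) [DecidableRel H.Adj]
    (A : Finset (Fin n)) (kA kB : ℕ) (col : Fin n → Fin m)
    (hcol : ∀ u v, H.Adj u v → col u ≠ col v) (hkA : kA ≤ m) (hm : m < kA + kB) :
    ∃ C : Circuit (Fin n), C.IsOver monotoneBasis01 ∧ C.size ≤ 1 + m * (n + 2 * (m - kA) + 3) ∧
      (∀ x : Finset (Fin n), x ⊆ A → H.IsNClique kA x →
        C.eval (fun v => decide (v ∈ x)) = true) ∧
      (∀ y : Finset (Fin n), H.IsNClique kB y →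
        C.eval (fun v => decide (v ∈ A ∧ ∀ w ∈ y, H.Adj v w)) = false) := by
  classical
  obtain ⟨C, hC, hsize, hacc, hrej⟩ := exists_circuit_fewZeroBlocks (Finset.univ : Finset (Fin m))
    (fun i => A.filter fun v => col v = i) (m - kA) n
    (fun i _ => (Finset.card_le_univ _).trans (by simp))
  refine ⟨C, hC, by simpa using hsize, fun x hxA hx => ?_, fun y hy => ?_⟩
  · -- a clique meets `kA` distinct colour classes, so exactly `m - kA` classes are missed
    have hinj : Set.InjOn col (x : Set (Fin n)) := fun u hu v hv huv => by
      by_contra hne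
      exact hcol u v (hx.1 hu hv hne) huv
    have hcard : (x.image col).card = kA := by
      rw [Finset.card_image_of_injOn hinj, hx.2]
    refine hacc _ (x.image col)ᶜ (fun i _ hi => ?_)
      (le_of_eq (by rw [Finset.card_compl, Fintype.card_fin, hcard]))
    rw [Finset.mem_compl, Finset.mem_image]
    rintro ⟨v, hv, rfl⟩
    have h0 := hi v (by rw [Finset.mem_filter]; exact ⟨hxA hv, rfl⟩)
    simp [hv] at h0
  · -- every colour of `y` darkens its whole class: at least `kB > m - kA` classes vanish
    have hinj : Set.InjOn col (y : Set (Fin n)) := fun u hu v hv huv => by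
      by_contra hne
      exact hcol u v (hy.1 hu hv hne) huv
    have hcard : (y.image col).card = kB := by
      rw [Finset.card_image_of_injOn hinj, hy.2]
    refine hrej _ (y.image col) (Finset.subset_univ _) (by omega) fun i hi v hv => ?_
    obtain ⟨w, hw, rfl⟩ := Finset.mem_image.1 hi
    rw [Finset.mem_filter] at hv
    simp only [decide_eq_false_iff_not, not_and, not_forall]
    exact fun _ => ⟨w, hw, fun hadj => hcol v w hadj hv.2⟩

/-! ## The common-neighbourhood threshold separator -/

/-- **The Bob-threshold separator, as a program.** On every graph: the monotone program
"at most `kB - 1` of the ORs `q_w = ⋁_{v ∈ A, v ≁ w} z_v`, `w ∈ B`, vanish"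
(`≤ 1 + |B| (n + 2 kB + 1)` gates) rejects the shadow `1_{A ∩ N(y)}` of EVERY `y ⊆ B` with
`|y| ≥ kB` (clique or not: `q_w` vanishes on the shadow for each `w ∈ y`) and accepts `1_x` for
every `x ⊆ A` with fewer than `kB` common neighbours in `B` (`q_w(1_x) = 0` iff `w` is a common
neighbour of `x`). Needs `1 ≤ kB`. `CktSize` form, for further composition
(`BadCliques.lean`). [folklore] -/
theorem exists_cktSize_threshold (H : SimpleGraph (Fin n)) [DecidableRel H.Adj]
    (A B : Finset (Fin n)) (kB : ℕ) (hkB : 1 ≤ kB) :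
    ∃ f : (Fin n → Bool) → Unit → Bool,
      CktSize monotoneBasis01 f (1 + B.card * (n + 2 * kB + 1)) ∧
      (∀ x : Finset (Fin n), x ⊆ A → (B.filter fun w => ∀ v ∈ x, H.Adj v w).card < kB →
        f (fun v => decide (v ∈ x)) () = true) ∧
      (∀ y : Finset (Fin n), y ⊆ B → kB ≤ y.card →
        f (fun v => decide (v ∈ A ∧ ∀ w ∈ y, H.Adj v w)) () = false) := by
  classical
  obtain ⟨f, hf, hacc, hrej⟩ := exists_cktSize_fewZeroBlocks B
    (fun w => A.filter fun v => ¬ H.Adj v w) (kB - 1) n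
    (fun w _ => (Finset.card_le_univ _).trans (by simp))
  refine ⟨f, hf.of_le (by apply Nat.add_le_add_left; apply Nat.mul_le_mul_left; omega),
    fun x hxA hx => ?_, fun y hyB hy => ?_⟩
  · refine hacc _ (B.filter fun w => ∀ v ∈ x, H.Adj v w) (fun w hwB hw => ?_)
      (Nat.le_sub_one_of_lt hx)
    rw [Finset.mem_filter]
    refine ⟨hwB, fun v hv => ?_⟩
    by_contra hadj
    have h0 := hw v (by rw [Finset.mem_filter]; exact ⟨hxA hv, hadj⟩)
    simp [hv] at h0
  · refine hrej _ y hyB (by omega) fun w hw v hv => ?_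
    rw [Finset.mem_filter] at hv
    simp only [decide_eq_false_iff_not, not_and, not_forall]
    exact fun _ => ⟨w, hw, hv.2⟩

/-- **The Bob-threshold separator** (circuit form of `exists_cktSize_threshold`): a monotone
circuit with `≤ 1 + |B| (n + 2 kB + 1)` gates rejecting the shadow of every `kB`-subset of `B`
and accepting every `x ⊆ A` with `< kB` common neighbours in `B`. Hence a monotone lower bound
for separating Alice cliques from Bob shadows is carried entirely by the cliques with `≥ kB`
common neighbours in `B`. [folklore] -/
theorem exists_threshold_separator (H : SimpleGraph (Fin n)) [DecidableRel H.Adj]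
    (A B : Finset (Fin n)) (kB : ℕ) (hkB : 1 ≤ kB) :
    ∃ C : Circuit (Fin n), C.IsOver monotoneBasis01 ∧ C.size ≤ 1 + B.card * (n + 2 * kB + 1) ∧
      (∀ x : Finset (Fin n), x ⊆ A → (B.filter fun w => ∀ v ∈ x, H.Adj v w).card < kB →
        C.eval (fun v => decide (v ∈ x)) = true) ∧
      (∀ y : Finset (Fin n), y ⊆ B → kB ≤ y.card →
        C.eval (fun v => decide (v ∈ A ∧ ∀ w ∈ y, H.Adj v w)) = false) := by
  obtain ⟨f, hf, hacc, hrej⟩ := exists_cktSize_threshold H A B kB hkB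
  obtain ⟨C, hC, hsize, heval⟩ := hf.toCircuit
  exact ⟨C, hC, hsize, fun x hxA hx => (heval _).trans (hacc x hxA hx),
    fun y hyB hy => (heval _).trans (hrej y hyB hy)⟩

end Summit.PneNP.PneNP.Theorems.ResolutionUncertainty.Negative
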